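import Summits.ResolutionOfSingularities.ResolutionOfSingularities.Theses.UniversalCells
import Literature.AlgebraicGeometry.Resolution.ProjectiveSpaceRegular
import Literature.AlgebraicGeometry.Resolution.PrincipalizationToResolution
import Literature.AlgebraicGeometry.Resolution.AbsoluteIntegralClosureNoResolution
import Literature.Barriers.ResolutionOfSingularities.InseparableBaseChangeResolution

/-!
# `UniversalCells.LocalToGlobal` — negative lemmas: shape, irrefutability, load-bearing guards

Support (negative) lemmas for the crux `stmt-ResolutionOfSingularities-15232`
(`Summit.ResolutionOfSingularities.ResolutionOfSingularities.Theses.UniversalCells.LocalToGlobal`,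
route `UniversalCells`, rank 4): for every prime `p`,

  `LocRes p` := every point of every integral separated finite-type `𝔽_p`-scheme has an open
  neighbourhood admitting a resolution of singularities, implies
  `Res p`    := every integral separated finite-type `𝔽_p`-scheme has a resolution.

Filed by the refuter's crux attack (2026-08-17; scratch `Scratch.lean` / `Fail.lean` of
refuter-rattack-stmt-ResolutionOfSingularities-15232-0). The file declares NO definition: `LocRes p`,
`Res p` and every dropped-hypothesis variant are written out inline.

## Findings (all sorry-free)

* §1 SHAPE. The converse `Res p → LocRes p` is trivial (`U = ⊤`; `locRes_of_res`), so the crux is,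
  prime by prime, the EQUIVALENCE `LocRes p ↔ Res p` (`localToGlobal_iff_forall_iff`), and it is
  exactly the route target `PrimeFieldThesis` weakened by its own antecedent:
  `PrimeFieldThesis ↔ LocalToGlobal ∧ ∀ p prime, LocRes p`
  (`primeFieldThesis_iff_localToGlobal_and_locRes`). The restates-the-summit probes `C → summit`,
  `C → PrimeFieldThesis`, `⊢ LocRes p`, `⊢ ¬ LocRes p`, `⊢ Res p` all fail by `exact?` against the
  tree (refuter `Fail.lean`, 10/10 fail); `summit → C` is `Theorems.localToGlobal_of_resolutionInChar`.
* §2 IRREFUTABILITY. `¬ LocalToGlobal ↔ ∃ p prime, LocRes p ∧ ¬ Res p` (`not_localToGlobal_iff`):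
  a refutation must PROVE pointwise-local resolution of everything over some `𝔽_p` (open from
  dimension 4, it implies local uniformization) and exhibit a non-resolvable integral
  `𝔽_p`-variety, i.e. refute the summit (`not_resolutionOfSingularities_of_not_localToGlobal`);
  modulo the vendored fact `CossartPiltant2019` that variety has dimension `≥ 4`
  (`not_localToGlobal_minimalCase`). Both sides hold at the base object `Spec 𝔽_p`
  (`hasResolution_Spec_zmod`, `locRes_at_Spec_zmod`): no junk instance decides the crux.
* §3 LOAD-BEARING GUARDS. Dropping `IsIntegral X` from the CONSEQUENT makes it false at every
  prime (`Spec 𝔽_p[ε]`, `res_false_without_isIntegral`) and turns the crux into "the antecedent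
  fails at every prime" (`localToGlobal_without_isIntegral_consequent_iff`); dropping
  `LocallyOfFiniteType f` from the consequent makes it false even for integral affine `X`
  (`Spec 𝔽_p[X]⁺`, `res_false_without_locallyOfFiniteType`). Dropping `IsIntegral X` from the
  ANTECEDENT makes the antecedent false (`locRes_false_without_isIntegral`: the one-point scheme
  `Spec 𝔽_p[ε]` has no resolvable neighbourhood), so that mutation of the crux is VACUOUSLY true
  (`localToGlobal_without_isIntegral_antecedent`). The integrality guard on both sides is what
  keeps the implication contentful; `IsReduced` would serve equally on the consequent side
  (resolution of the irreducible components, `hasResolution_of_irreducibleComponents`, in tree).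

## Sources
* Y. Hu, arXiv:2109.02968 (2021), p. 65 ("it remains to glue finitely many local resolutions").
* M. Temkin, *Desingularization of quasi-excellent schemes in characteristic zero*, Adv. Math.
  219 (2008), Prop. 2.3.4 (the semi-local, `X_reg`-admissible criterion — strictly stronger input).
* V. Cossart, O. Piltant, J. Algebra 529 (2019), Thm. 1.1 (dimension `≤ 3`).
-/

noncomputable section

-- single-problem summit: the doubled namespace component `ResolutionOfSingularities` is forced
set_option linter.dupNamespace false

open CategoryTheory AlgebraicGeometry Literature.AlgebraicGeometry.Resolution
open Literature.Barriers.ResolutionOfSingularities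
open Summit.ResolutionOfSingularities.ResolutionOfSingularities.Theses.UniversalCells
  (LocalToGlobal PrimeFieldThesis)

namespace Summit.ResolutionOfSingularities.ResolutionOfSingularities.Theorems.LocalToGlobal.Negative

/-! ## §1 Shape: the crux is `LocRes p ↔ Res p`, i.e. the target modulo its antecedent -/

/-- `Res p → LocRes p` is trivial: a resolution of `X` restricts to one of the open `⊤ ∋ x`.
[folklore] -/
theorem locRes_of_res {p : ℕ}
    (h : ∀ (X : Scheme.{0}) (f : X ⟶ Spec (.of (ZMod p))), IsSeparated f → LocallyOfFiniteType f →
      QuasiCompact f → IsIntegral X → Scheme.HasResolution X)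
    (X : Scheme.{0}) (f : X ⟶ Spec (.of (ZMod p))) (hs : IsSeparated f)
    (hl : LocallyOfFiniteType f) (hq : QuasiCompact f) (hi : IsIntegral X) (x : X) :
    ∃ U : X.Opens, x ∈ U ∧ Scheme.HasResolution (U : Scheme.{0}) :=
  ⟨⊤, trivial, (h X f hs hl hq hi).restrict ⊤⟩

/-- The crux is, prime by prime, the equivalence of pointwise-local and global resolvability over
`𝔽_p`. [folklore] -/
theorem localToGlobal_iff_forall_iff :
    LocalToGlobal ↔ ∀ p : ℕ, p.Prime →
      ((∀ (X : Scheme.{0}) (f : X ⟶ Spec (.of (ZMod p))), IsSeparated f → LocallyOfFiniteType f →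
          QuasiCompact f → IsIntegral X →
            ∀ x : X, ∃ U : X.Opens, x ∈ U ∧ Scheme.HasResolution (U : Scheme.{0})) ↔
        ∀ (X : Scheme.{0}) (f : X ⟶ Spec (.of (ZMod p))), IsSeparated f → LocallyOfFiniteType f →
          QuasiCompact f → IsIntegral X → Scheme.HasResolution X) :=
  ⟨fun h p hp => ⟨h p hp, fun hR X f hs hl hq hi x => locRes_of_res hR X f hs hl hq hi x⟩,
    fun h p hp => (h p hp).1⟩

/-- The route target `PrimeFieldThesis` is exactly the crux together with its antecedent at every
prime: `LocalToGlobal` is the target weakened by pointwise-local resolvability and by nothing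
else. [folklore] -/
theorem primeFieldThesis_iff_localToGlobal_and_locRes :
    PrimeFieldThesis ↔ LocalToGlobal ∧ ∀ p : ℕ, p.Prime →
      ∀ (X : Scheme.{0}) (f : X ⟶ Spec (.of (ZMod p))), IsSeparated f → LocallyOfFiniteType f →
        QuasiCompact f → IsIntegral X →
          ∀ x : X, ∃ U : X.Opens, x ∈ U ∧ Scheme.HasResolution (U : Scheme.{0}) :=
  ⟨fun h => ⟨fun p hp _ => h p hp, fun p hp X f hs hl hq hi x => locRes_of_res (h p hp) X f hs hl hq hi x⟩,
    fun h p hp => h.1 p hp (h.2 p hp)⟩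

/-! ## §2 Irrefutability and the shape of a counterexample -/

/-- A refutation of the crux is a prime `p` at which pointwise-local resolution over `𝔽_p` HOLDS
and global resolution FAILS. [folklore] -/
theorem not_localToGlobal_iff :
    ¬ LocalToGlobal ↔ ∃ p : ℕ, p.Prime ∧
      (∀ (X : Scheme.{0}) (f : X ⟶ Spec (.of (ZMod p))), IsSeparated f → LocallyOfFiniteType f →
          QuasiCompact f → IsIntegral X →
            ∀ x : X, ∃ U : X.Opens, x ∈ U ∧ Scheme.HasResolution (U : Scheme.{0})) ∧
      ¬ ∀ (X : Scheme.{0}) (f : X ⟶ Spec (.of (ZMod p))), IsSeparated f → LocallyOfFiniteType f →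
          QuasiCompact f → IsIntegral X → Scheme.HasResolution X := by
  constructor
  · intro h
    by_contra hne
    exact h fun p hp hloc => by_contra fun hR => hne ⟨p, hp, hloc, hR⟩
  · rintro ⟨p, hp, hloc, hR⟩ h
    exact hR (h p hp hloc)

/-- In particular a refutation of the crux refutes the summit (whose `𝔽_p`-slice is the consequent:
`ZMod p` is a field of characteristic `p` and integral schemes are reduced). [folklore] -/
theorem not_resolutionOfSingularities_of_not_localToGlobal (h : ¬ LocalToGlobal) :
    ¬ _root_.ResolutionOfSingularities := by
  intro hS
  obtain ⟨p, hp, -, hR⟩ := not_localToGlobal_iff.mp h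
  haveI : Fact p.Prime := ⟨hp⟩
  exact hR fun X f hs hl hq _ => hS p hp (ZMod p) X f hs hl hq inferInstance

/-- Modulo the vendored fact `CossartPiltant2019` (dimension `≤ 3`), a counterexample to the crux
consists of a prime `p` with pointwise-local resolution over `𝔽_p` and an integral separated
finite-type `𝔽_p`-scheme of dimension `≥ 4` (`¬ dim ≤ 3`) without a resolution.
[cite: CossartPiltant2019, Thm. 1.1] -/
theorem not_localToGlobal_minimalCase (hCP : CossartPiltant2019.{0}) (h : ¬ LocalToGlobal) :
    ∃ p : ℕ, p.Prime ∧
      (∀ (X : Scheme.{0}) (f : X ⟶ Spec (.of (ZMod p))), IsSeparated f → LocallyOfFiniteType f →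
          QuasiCompact f → IsIntegral X →
            ∀ x : X, ∃ U : X.Opens, x ∈ U ∧ Scheme.HasResolution (U : Scheme.{0})) ∧
      ∃ (X : Scheme.{0}) (f : X ⟶ Spec (.of (ZMod p))), IsSeparated f ∧ LocallyOfFiniteType f ∧
        QuasiCompact f ∧ IsIntegral X ∧ ¬ topologicalKrullDim X ≤ 3 ∧ ¬ Scheme.HasResolution X := by
  obtain ⟨p, hp, hloc, hR⟩ := not_localToGlobal_iff.mp h
  refine ⟨p, hp, hloc, ?_⟩
  by_contra hne
  refine hR fun X f hs hl hq hi => ?_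
  by_contra hX
  refine hne ⟨X, f, hs, hl, hq, hi, fun hdim => hX ?_, hX⟩
  haveI : Fact p.Prime := ⟨hp⟩
  haveI := hs; haveI := hl; haveI := hq; haveI := hi
  exact hasResolution_of_dim_le_three hCP (p := p) (ZMod p) X f hdim

/-- No junk instance decides the crux: the base object `Spec 𝔽_p` (integral, and `𝟙` is
separated, locally of finite type, quasi-compact) is regular, hence resolved … [folklore] -/
theorem hasResolution_Spec_zmod (p : ℕ) [Fact p.Prime] :
    Scheme.HasResolution (Spec (.of (ZMod p))) :=
  (Scheme.isRegular_Spec (.of (ZMod p))).hasResolution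

/-- … and pointwise-locally resolvable. [folklore] -/
theorem locRes_at_Spec_zmod (p : ℕ) [Fact p.Prime] (x : Spec (.of (ZMod p))) :
    ∃ U : (Spec (.of (ZMod p))).Opens, x ∈ U ∧ Scheme.HasResolution (U : Scheme.{0}) :=
  ⟨⊤, trivial, (hasResolution_Spec_zmod p).restrict ⊤⟩

/-! ## §3 Load-bearing guards (hypothesis mutation) -/

/-- Dropping `IsIntegral X` from the CONSEQUENT makes it false at every prime: the one-point
non-reduced scheme `Spec 𝔽_p[ε]` has no resolution (a resolution is an isomorphism over a dense
open, here everything, onto an open of a regular — hence reduced — scheme). [folklore] -/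
theorem res_false_without_isIntegral (p : ℕ) [Fact p.Prime] :
    ¬ ∀ (X : Scheme.{0}) (f : X ⟶ Spec (.of (ZMod p))), IsSeparated f → LocallyOfFiniteType f →
        QuasiCompact f → Scheme.HasResolution X := by
  intro h
  let f : Spec (.of (DualNumber (ZMod p))) ⟶ Spec (.of (ZMod p)) :=
    Spec.map (CommRingCat.ofHom (algebraMap (ZMod p) (DualNumber (ZMod p))))
  haveI : LocallyOfFiniteType f := locallyOfFiniteType_Spec_dualNumber (ZMod p)
  exact not_hasResolution_Spec_dualNumber (ZMod p) (h _ f inferInstance inferInstance inferInstance)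

/-- Hence with `IsIntegral X` dropped from the consequent the crux says "pointwise-local
resolution over `𝔽_p` FAILS at every prime" — false as soon as local resolution holds in one
positive characteristic. [folklore] -/
theorem localToGlobal_without_isIntegral_consequent_iff :
    (∀ p : ℕ, p.Prime →
      (∀ (X : Scheme.{0}) (f : X ⟶ Spec (.of (ZMod p))), IsSeparated f → LocallyOfFiniteType f →
          QuasiCompact f → IsIntegral X →
            ∀ x : X, ∃ U : X.Opens, x ∈ U ∧ Scheme.HasResolution (U : Scheme.{0})) →
        ∀ (X : Scheme.{0}) (f : X ⟶ Spec (.of (ZMod p))), IsSeparated f → LocallyOfFiniteType f →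
          QuasiCompact f → Scheme.HasResolution X) ↔
    ∀ p : ℕ, p.Prime →
      ¬ ∀ (X : Scheme.{0}) (f : X ⟶ Spec (.of (ZMod p))), IsSeparated f → LocallyOfFiniteType f →
          QuasiCompact f → IsIntegral X →
            ∀ x : X, ∃ U : X.Opens, x ∈ U ∧ Scheme.HasResolution (U : Scheme.{0}) := by
  refine forall₂_congr fun p hp => ⟨fun h hloc => ?_, fun h hloc => absurd hloc h⟩
  haveI : Fact p.Prime := ⟨hp⟩
  exact res_false_without_isIntegral p (h hloc)

/-- Dropping `LocallyOfFiniteType f` from the CONSEQUENT makes it false even for integral affine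
`X`: `Spec 𝔽_p[X]⁺` (absolute integral closure of `𝔽_p[X]`; a domain all of whose elements have
square roots and whose local rings are not fields) has no resolution. [folklore] -/
theorem res_false_without_locallyOfFiniteType (p : ℕ) [Fact p.Prime] :
    ¬ ∀ (X : Scheme.{0}) (f : X ⟶ Spec (.of (ZMod p))), IsSeparated f → QuasiCompact f →
        IsIntegral X → Scheme.HasResolution X := by
  intro h
  let f : Spec (.of ↥(integralClosure (Polynomial (ZMod p)) (AlgebraicClosure (RatFunc (ZMod p))))) ⟶
      Spec (.of (ZMod p)) :=
    Spec.map (CommRingCat.ofHom ((algebraMap (Polynomial (ZMod p))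
      ↥(integralClosure (Polynomial (ZMod p)) (AlgebraicClosure (RatFunc (ZMod p))))).comp
        Polynomial.C))
  exact not_hasResolution_spec_absoluteIntegralClosure p
    (h _ f inferInstance inferInstance inferInstance)

/-- Dropping `IsIntegral X` from the ANTECEDENT makes the antecedent false at every prime: the
unique point of `Spec 𝔽_p[ε]` has no resolvable open neighbourhood (its only neighbourhood is the
whole non-reduced scheme). [folklore] -/
theorem locRes_false_without_isIntegral (p : ℕ) [Fact p.Prime] :
    ¬ ∀ (X : Scheme.{0}) (f : X ⟶ Spec (.of (ZMod p))), IsSeparated f → LocallyOfFiniteType f →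
        QuasiCompact f → ∀ x : X, ∃ U : X.Opens, x ∈ U ∧ Scheme.HasResolution (U : Scheme.{0}) := by
  intro h
  let X : Scheme.{0} := Spec (.of (DualNumber (ZMod p)))
  let f : X ⟶ Spec (.of (ZMod p)) :=
    Spec.map (CommRingCat.ofHom (algebraMap (ZMod p) (DualNumber (ZMod p))))
  haveI : LocallyOfFiniteType f := locallyOfFiniteType_Spec_dualNumber (ZMod p)
  haveI : Subsingleton ↥X :=
    subsingleton_primeSpectrum_of_isUnit_or_isNilpotent TrivSqZeroExt.isUnit_or_isNilpotent
  let x : ↥X := (Classical.arbitrary (PrimeSpectrum (DualNumber (ZMod p))) : PrimeSpectrum _)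
  obtain ⟨U, hxU, hU⟩ := h X f inferInstance inferInstance inferInstance x
  have hUtop : U = ⊤ := by
    ext y
    simp only [TopologicalSpace.Opens.coe_top, Set.mem_univ, iff_true]
    rwa [Subsingleton.elim y x]
  subst hUtop
  exact not_hasResolution_Spec_dualNumber (ZMod p) (Scheme.HasResolution.of_iso X.topIso.hom hU)

/-- Hence the crux with `IsIntegral X` dropped from its ANTECEDENT is vacuously true: the
integrality guard of the antecedent is what keeps `LocalToGlobal` contentful. [folklore] -/
theorem localToGlobal_without_isIntegral_antecedent :
    ∀ p : ℕ, p.Prime →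
      (∀ (X : Scheme.{0}) (f : X ⟶ Spec (.of (ZMod p))), IsSeparated f → LocallyOfFiniteType f →
          QuasiCompact f → ∀ x : X, ∃ U : X.Opens, x ∈ U ∧ Scheme.HasResolution (U : Scheme.{0})) →
        ∀ (X : Scheme.{0}) (f : X ⟶ Spec (.of (ZMod p))), IsSeparated f → LocallyOfFiniteType f →
          QuasiCompact f → IsIntegral X → Scheme.HasResolution X := by
  intro p hp h
  haveI : Fact p.Prime := ⟨hp⟩
  exact absurd h (locRes_false_without_isIntegral p)

end Summit.ResolutionOfSingularities.ResolutionOfSingularities.Theorems.LocalToGlobal.Negative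

end
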